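import Summits.ResolutionOfSingularities.ResolutionOfSingularities.Theorems.FrobeniusLadderFRationalResolutionPermutationAction
import Summits.ResolutionOfSingularities.ResolutionOfSingularities.Theorems.FrobeniusLadderFRationalResolutionSafeLadder
import HarnessLib

/-!
# Crux `FrobeniusLadder.FRationalResolution` (stmt-ResolutionOfSingularities-15317), line `redirect`,
# stub `stub_diagonalizableQuotientResolution` — ONE ENTRY POINT: the equivariant safe projective ladder from WEIGHT DATA (lane W‴)

Composition of the generation's bricks into the single statement the assembly L3 consumes: from weights `c : Fin n → A`
(killed by `d > 0`, none zero), the no-pseudo-reflection and isolatedness conditions on the dual lattice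
`N = {v | ⟨m, v⟩ ∈ ℤ for all weight-0 exponents m}`, and a finite group `Perms` of coordinate permutations preserving `N`
(the weight permutations of the twisted chart comparison), we get the coordinate change `φ` (`…DualLatticeWeights`), the
ladder fan with its `G`-invariant integral tight strict support data (`…SafeLadder`, `G = φ Perms φ⁻¹` by `…PermutationAction`,
hypotheses by `…IsolatedConeHypotheses`), ONE invariant order function (`…InvariantSupport.exists_invariant_orderFunction`),
and the e-coordinate interface of `…SafeRayCentreStable.map_span_centre_le_span_centre` (✓ p830301): the preimages
`φ⁻¹ r` of the non-`S₀` generators are SUBSTITUTION-SAFE, permuted by `v ↦ v ∘ π`, and the order function is `π`-invariant.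

* **`exists_weightLadder`** — the entry point.

Honest label: packaging for the DESIGN W‴ (no new mathematics; consumers L1/L3 are NOT in the tree). No stub closed by name.
No definitions, no named facts, no sorry. [cite: KempfEtAl1973, Ch. I §2 Thm. 10, Thm. 11, Ch. II §2] [cite: Fulton1993Toric, §2.6 p. 48]
-/

-- single-problem summit: the doubled namespace component is forced
set_option linter.dupNamespace false

namespace Summit.ResolutionOfSingularities.ResolutionOfSingularities.Theorems.FRationalResolution.WeightLadder

open Literature.Geometry.PolyhedralFans PointedCone Finset
open Summit.ResolutionOfSingularities.ResolutionOfSingularities.Theorems.FRationalResolution.EquivariantStep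
open Summit.ResolutionOfSingularities.ResolutionOfSingularities.Theorems.FRationalResolution.InvariantSupport
open Summit.ResolutionOfSingularities.ResolutionOfSingularities.Theorems.FRationalResolution.SafeLadder
open Summit.ResolutionOfSingularities.ResolutionOfSingularities.Theorems.FRationalResolution.DualLatticeWeights
open Summit.ResolutionOfSingularities.ResolutionOfSingularities.Theorems.FRationalResolution.IsolatedConeHypotheses
open Summit.ResolutionOfSingularities.ResolutionOfSingularities.Theorems.FRationalResolution.PermutationAction

variable {n : ℕ} {A : Type} [AddCommGroup A]

/-- **THE EQUIVARIANT SAFE PROJECTIVE LADDER FROM WEIGHT DATA (lane W‴ entry point).** Inputs: weights `c` with `d • A = 0`,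
`d > 0`, no `c l = 0`, `n ≥ 2`; on the dual lattice `N` of the weight-`0` exponents: no pseudo-reflection along any axis
(`q • e_l ∈ N`, `q > 0` ⇒ `q ≥ 1`) and isolatedness (a vector of `N` with a vanishing coordinate is integral); a finite group
`Perms` of permutations with `v ∈ N ⇒ v ∘ π ∈ N`. Outputs: a coordinate change `φ` (`v ∈ N ↔ φ v ∈ ℤⁿ`), a list of star points,
the ladder fan `Δ'` of `σ = hull φ(e_•)` — regular, primitively simplicial, stable under every `φ P_π φ⁻¹`, keeping the proper faces
of `σ` —, integral tight strict support data `m` (`≥ 0` on `σ`, `= 0` on `∂σ`, `> 0` somewhere), ONE order function `f = m ρ·_` on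
cones, and the e-coordinate interface: every non-`S₀` generator `r` has SUBSTITUTION-SAFE preimage `φ⁻¹ r`, its permuted preimage
`(φ⁻¹ r) ∘ π` is again the preimage of a non-`S₀` generator, and `f (φ ((φ⁻¹ x) ∘ π)) = f x` on `σ`.
[cite: KempfEtAl1973, Ch. I §2 Thm. 10, Thm. 11, Ch. II §2] [cite: Fulton1993Toric, §2.6 p. 48] -/
theorem exists_weightLadder (c : Fin n → A) (d : ℕ) (hd : 0 < d) (hdA : ∀ a : A, d • a = 0) (hc0 : ∀ l, c l ≠ 0)
    (h2 : 2 ≤ n)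
    (hnpr : ∀ (l : Fin n) (q : ℚ), 0 < q →
      (∀ m : Fin n → ℤ, ∑ l', m l' • c l' = 0 → ∃ z : ℤ, ∑ l', (m l' : ℚ) * (q • (Pi.single l (1 : ℚ) : Fin n → ℚ)) l' = z) →
      1 ≤ q)
    (hisoN : ∀ v : Fin n → ℚ, (∀ m : Fin n → ℤ, ∑ l, m l • c l = 0 → ∃ z : ℤ, ∑ l, (m l : ℚ) * v l = z) →
      (∃ l, v l = 0) → v ∈ latticeN (Fin n))
    {Perms : Set (Equiv.Perm (Fin n))} (hPfin : Perms.Finite) (hP1 : Equiv.refl (Fin n) ∈ Perms)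
    (hPsymm : ∀ π ∈ Perms, π.symm ∈ Perms) (hPtrans : ∀ π ∈ Perms, ∀ π' ∈ Perms, π.trans π' ∈ Perms)
    (hPN : ∀ π ∈ Perms, ∀ v : Fin n → ℚ, (∀ m : Fin n → ℤ, ∑ l, m l • c l = 0 → ∃ z : ℤ, ∑ l, (m l : ℚ) * v l = z) →
      ∀ m : Fin n → ℤ, ∑ l, m l • c l = 0 → ∃ z : ℤ, ∑ l, (m l : ℚ) * (fun l => v (π l)) l = z) :
    ∃ (φ : (Fin n → ℚ) ≃ₗ[ℚ] (Fin n → ℚ))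
      (hfg : (PointedCone.hull ℚ ((Finset.univ.image fun l : Fin n => φ (Pi.single l (1 : ℚ))) : Set (Fin n → ℚ))).FG)
      (hsal : IsSalient (PointedCone.hull ℚ ((Finset.univ.image fun l : Fin n => φ (Pi.single l (1 : ℚ))) : Set (Fin n → ℚ))))
      (l : List (Fin n → ℚ)) (m : PointedCone ℚ (Fin n → ℚ) → (Fin n → ℚ)) (f : (Fin n → ℚ) → ℚ),
      (∀ v : Fin n → ℚ, (∀ m' : Fin n → ℤ, ∑ l, m' l • c l = 0 → ∃ z : ℤ, ∑ l, (m' l : ℚ) * v l = z) ↔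
        φ v ∈ latticeN (Fin n)) ∧
      ((Fan.ofCone _ hfg hsal).starIter l).Refines (Fan.ofCone _ hfg hsal) ∧
      ((Fan.ofCone _ hfg hsal).starIter l).IsRegular ∧
      ((Fan.ofCone _ hfg hsal).starIter l).IsPrimSimplicial ∧
      (∀ π ∈ Perms, ∀ ρ ∈ ((Fan.ofCone _ hfg hsal).starIter l).cones,
        ρ.map ((φ.symm.trans ((LinearEquiv.funCongrLeft ℚ ℚ π).trans φ) : (Fin n → ℚ) ≃ₗ[ℚ] (Fin n → ℚ)) :
          (Fin n → ℚ) →ₗ[ℚ] (Fin n → ℚ)) ∈ ((Fan.ofCone _ hfg hsal).starIter l).cones) ∧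
      (∀ τ : PointedCone ℚ (Fin n → ℚ),
        τ.IsFaceOf (PointedCone.hull ℚ ((Finset.univ.image fun l : Fin n => φ (Pi.single l (1 : ℚ))) : Set (Fin n → ℚ))) →
        τ ≠ PointedCone.hull ℚ ((Finset.univ.image fun l : Fin n => φ (Pi.single l (1 : ℚ))) : Set (Fin n → ℚ)) →
          τ ∈ ((Fan.ofCone _ hfg hsal).starIter l).cones) ∧
      ((Fan.ofCone _ hfg hsal).starIter l).IsStrictSupport m ∧
      (∀ ρ ∈ ((Fan.ofCone _ hfg hsal).starIter l).cones, m ρ ∈ latticeN (Fin n)) ∧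
      (∀ ρ ∈ ((Fan.ofCone _ hfg hsal).starIter l).cones,
        ∀ x ∈ PointedCone.hull ℚ ((Finset.univ.image fun l : Fin n => φ (Pi.single l (1 : ℚ))) : Set (Fin n → ℚ)),
          0 ≤ m ρ ⬝ᵥ x) ∧
      (∀ τ : PointedCone ℚ (Fin n → ℚ),
        τ.IsFaceOf (PointedCone.hull ℚ ((Finset.univ.image fun l : Fin n => φ (Pi.single l (1 : ℚ))) : Set (Fin n → ℚ))) →
        τ ≠ PointedCone.hull ℚ ((Finset.univ.image fun l : Fin n => φ (Pi.single l (1 : ℚ))) : Set (Fin n → ℚ)) →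
        ∀ ρ ∈ ((Fan.ofCone _ hfg hsal).starIter l).cones, ∀ x ∈ ρ, x ∈ τ → m ρ ⬝ᵥ x = 0) ∧
      (∃ ρ ∈ ((Fan.ofCone _ hfg hsal).starIter l).cones, ∃ x ∈ ρ, 0 < m ρ ⬝ᵥ x) ∧
      (∀ ρ ∈ ((Fan.ofCone _ hfg hsal).starIter l).cones, ∀ x ∈ ρ, f x = m ρ ⬝ᵥ x) ∧
      (∀ ρ ∈ ((Fan.ofCone _ hfg hsal).starIter l).cones, ∀ K : Finset (Fin n → ℚ), IsPrimGens ρ K → ∀ r ∈ K,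
        r ∉ (Finset.univ.image fun l : Fin n => φ (Pi.single l (1 : ℚ))) →
          ∀ (u : Fin n → ℕ) (l₀ : Fin n), ∑ l, u l • c l = c l₀ → φ.symm r l₀ ≤ ∑ l, (u l : ℚ) * φ.symm r l) ∧
      (∀ π ∈ Perms, ∀ ρ ∈ ((Fan.ofCone _ hfg hsal).starIter l).cones, ∀ K : Finset (Fin n → ℚ), IsPrimGens ρ K →
        ∀ r ∈ K, r ∉ (Finset.univ.image fun l : Fin n => φ (Pi.single l (1 : ℚ))) →
          ∃ ρ' ∈ ((Fan.ofCone _ hfg hsal).starIter l).cones, ∃ K' : Finset (Fin n → ℚ), IsPrimGens ρ' K' ∧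
            φ (fun l => φ.symm r (π l)) ∈ K' ∧
            φ (fun l => φ.symm r (π l)) ∉ (Finset.univ.image fun l : Fin n => φ (Pi.single l (1 : ℚ)))) ∧
      (∀ π ∈ Perms,
        ∀ x ∈ PointedCone.hull ℚ ((Finset.univ.image fun l : Fin n => φ (Pi.single l (1 : ℚ))) : Set (Fin n → ℚ)),
          f (φ (fun l => φ.symm x (π l))) = f x) := by
  classical
  obtain ⟨φ, hφ⟩ := exists_linearEquiv_dualLattice c d hd hdA
  -- the dual lattice as a set, and the hypotheses of the safe ladder
  set N : Set (Fin n → ℚ) := {v | ∀ m : Fin n → ℤ, ∑ l, m l • c l = 0 → ∃ z : ℤ, ∑ l, (m l : ℚ) * v l = z} with hNdef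
  have hφN : ∀ v, v ∈ N ↔ φ v ∈ latticeN (Fin n) := fun v => hφ v
  have hsub : ∀ l : Fin n, (Pi.single l (1 : ℚ) : Fin n → ℚ) ∈ N := fun l m _ => ⟨m l, pairing_single m l⟩
  set S₀ : Finset (Fin n → ℚ) := Finset.univ.image fun l : Fin n => φ (Pi.single l (1 : ℚ)) with hS₀
  have hprim : ∀ s ∈ S₀, IsPrimitive s := by
    intro s hs
    obtain ⟨l, -, rfl⟩ := Finset.mem_image.mp hs
    exact isPrimitive_map_single φ hφN l (hsub l) (fun q hq hqN => hnpr l q hq hqN)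
  have hli := linearIndepOn_image_single φ
  have hcard : 2 ≤ S₀.card := by rw [hS₀, card_image_single φ]; exact h2
  have hiso : ∀ J : Finset (Fin n → ℚ), J ⊂ S₀ → IsRegularGens J := fun J hJ =>
    isRegularGens_of_ssubset_image_single φ hφN hsub (fun v hv hl => hisoN v hv hl) hJ
  have hfg := fg_hull_finset S₀
  have hsal := isSalient_hull_of_linearIndepOn hli
  obtain ⟨hGfin, hG1, hGN, hGsymm, hGtrans, hGS₀⟩ :=
    conjSet_hypotheses φ hφN hPfin hP1 hPsymm hPtrans (fun π hπ v hv => hPN π hπ v hv)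
  obtain ⟨l, hl, href, hreg, hps, hG, hfaces, hP, m, hm, hint, hnn, hvan, hinv, hpos⟩ :=
    exists_equivariant_projective_ladder_safe c hc0 φ (fun v hv => (hφN v).2 hv) hprim hli hcard hiso hfg hsal hGfin hG1
      hGN hGsymm hGtrans hGS₀
  obtain ⟨f, hf, hfinv⟩ := exists_invariant_orderFunction hm hG hinv
  have hsupp : ((Fan.ofCone _ hfg hsal).starIter l).support = (PointedCone.hull ℚ (S₀ : Set (Fin n → ℚ)) : Set (Fin n → ℚ)) := by
    rw [href.support_eq, Fan.support_ofCone]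
  have hgπ : ∀ π : Equiv.Perm (Fin n), ∀ x : Fin n → ℚ,
      φ (fun l => φ.symm x (π l)) = (φ.symm.trans ((LinearEquiv.funCongrLeft ℚ ℚ π).trans φ)) x := fun π x => rfl
  refine ⟨φ, hfg, hsal, l, m, f, hφ, href, hreg, hps, ?_, fun τ hτ hne => (hfaces τ hτ hne).1, hm, hint, hnn, hvan, hpos, hf,
    ?_, ?_, ?_⟩
  · intro π hπ ρ hρ
    exact hG _ ⟨π, hπ, rfl⟩ ρ hρ
  · intro ρ hρ K hK r hr hrS
    rcases hP ρ hρ K hK r hr with h | h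
    · exact absurd h hrS
    · exact h
  · intro π hπ ρ hρ K hK r hr hrS
    set g := φ.symm.trans ((LinearEquiv.funCongrLeft ℚ ℚ π).trans φ) with hgdef
    have hg : g ∈ (fun π : Equiv.Perm (Fin n) => φ.symm.trans ((LinearEquiv.funCongrLeft ℚ ℚ π).trans φ)) '' Perms :=
      ⟨π, hπ, rfl⟩
    obtain ⟨hK', -, -, -, -⟩ := orbit_point g (hGN g hg) (hGN _ (hGsymm g hg)) hK (zero_mem_parCoeffs K)
    refine ⟨_, hG g hg ρ hρ, K.image g, hK', ?_, ?_⟩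
    · rw [hgπ]; exact Finset.mem_image_of_mem g hr
    · rw [hgπ]
      intro hmem
      have := hGS₀ _ (hGsymm g hg) _ hmem
      rw [LinearEquiv.symm_apply_apply] at this
      exact hrS this
  · intro π hπ x hx
    rw [hgπ]
    exact hfinv _ ⟨π, hπ, rfl⟩ x (by rw [hsupp]; exact hx)

end Summit.ResolutionOfSingularities.ResolutionOfSingularities.Theorems.FRationalResolution.WeightLadder
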